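import Mathlib
import Summits.Ventures.PercRepro2.HCov
import Summits.Ventures.PercRepro2.HCovSwap
import Summits.Ventures.PercRepro2.OddsLemma
import Summits.Ventures.PercRepro2.J1Regime
import Summits.Ventures.PercRepro2.RV

/-!
# The `S = C₁`-revealed objects of the (J1) line and the exact identities (i), (ii) at `S`-level
(blind cell PercRepro2, typer-1 g9; ASSIGNMENTS v12.48 «type the S-level objects»; lead g24 INBOX
23:45:26Z «THE S = C₁-REVEALED FORMS OF (i) AND (ii)», mining/lead/g24/README)

Reveal `S = C(a₁)` under `Q = {a₁ ↮ a₂}`.  Objects (all functions of the revealed cluster `S`):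
* `hS x S = P_{G∖S}(x ∈ C(a₂))` (the tree's `delClusterProb p ends a₂ {W | x ∈ W} S`), `hS2 x y S = P_{G∖S}(x, y ∈ C(a₂))`;
* `indS x S = 1[x ∈ S]` (`e = indS a₃`); `slack x y S = h_{xy}(S) − h_x(S) h_y(S)` (`≥ 0`: Harris in `G ∖ S`);
* `covS F G = P(Q)·E[F(C₁) G(C₁) 1_Q] − E[F(C₁) 1_Q]·E[G(C₁) 1_Q] = P(Q)² · Cov_{S∼Q}(F, G)` (cleared);
* `phi S = e(S)·(D·h_o(S) − D_o) = D · e(S) · (h_o(S) − γ)`, `D = P(PD)`, `D_o = P(PD, o ∈ C₁ ∪ C₂)`, `γ = D_o/D`.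

Exact identities (the lead's, digit-checked on 68,640 instances; here in the kernel):
* **(i) = `Cov_{S∼Q}(1[b ∈ S], e·(γ − h_o(S)))`**: `covS (indS b) phi` equals the cleared table form of (i),
  `P(Q)·(D·P(T′, o∈C₂, b∈C₁) − D_o·P(T′, b∈C₁)) − P(Q, b∈C₁)·(D·P(T′, o∈C₂) − D_o·P(T′))` (`covS_indS_phi_eq`);
* **(ii) = `E_Q[e · Cov_{G∖S}(b, o ∈ C(a₂))] + Cov_{S∼Q}(h_b, e·(h_o − γ))`**:
  `J1RV.rvTableExpr = D·P(Q)·E[e · slack b o · 1_Q] + covS (hS b) phi` (`rvTableExpr_eq_slack_add_covS`),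
  first term `≥ 0` (Harris in `G ∖ S`, `SLevelRegime.lean`) — so the candidate strengthening (SC)
  `0 ≤ covS (hS b) phi` implies (ii) = (RV) in table form (no (SC) `Prop` is declared — it waits for the
  engine twin, v12.48).
The sign statements (`harris_slack_nonneg`, `rvTable_of_covS_nonneg`) and the regime mechanism theorems
(BHK06 Thm 1.3 on `C₁`: `covS_indS_phi_nonpos_of_regime`, `covS_hS_phi_nonneg_of_regime`) are in
`SLevelRegime.lean`.
-/

namespace Summit.Ventures.PercRepro2

open UnionCluster

namespace SLevel

section Defs

variable {V : Type*} {E : Type*} [Fintype E] [DecidableEq E] {R : Type*} [Field R]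

/-- `h_x(S) = P_{G∖S}(x ∈ C(a₂))`: the connection weight of `x` to the root `a₂` through the hole `S`. -/
noncomputable def hS (p : E → R) (ends : E → Sym2 V) (a₂ x : V) (S : Set V) : R :=
  delClusterProb p ends a₂ {W : Set V | x ∈ W} S

/-- `h_{xy}(S) = P_{G∖S}(x ∈ C(a₂), y ∈ C(a₂))`. -/
noncomputable def hS2 (p : E → R) (ends : E → Sym2 V) (a₂ x y : V) (S : Set V) : R :=
  delClusterProb p ends a₂ ({W : Set V | x ∈ W} ∩ {W : Set V | y ∈ W}) S

/-- `1_x(S) = 1[x ∈ S]` (`e = indS a₃`). -/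
noncomputable def indS (x : V) (S : Set V) : R :=
  ({W : Set V | x ∈ W} : Set (Set V)).indicator (1 : Set V → R) S

/-- The Harris slack in `G ∖ S`: `h_{xy}(S) − h_x(S) h_y(S) = Cov_{G∖S}(x ∈ C(a₂), y ∈ C(a₂))`. -/
noncomputable def slack (p : E → R) (ends : E → Sym2 V) (a₂ x y : V) (S : Set V) : R :=
  hS2 p ends a₂ x y S - hS p ends a₂ x S * hS p ends a₂ y S

/-- The cleared covariance of two functionals of the revealed cluster `S = C₁` under `Q`:
`covS F G = P(Q)·E[F(C₁) G(C₁) 1_Q] − E[F(C₁) 1_Q]·E[G(C₁) 1_Q] = P(Q)² · Cov_{S∼Q}(F, G)`. -/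
noncomputable def covS (p : E → R) (ends : E → Sym2 V) (a₁ a₂ : V) (F G : Set V → R) : R :=
  prob p (avoidAll ends a₂ {a₁}) *
      expect p (fun ω => F (cluster ends ω a₁) * G (cluster ends ω a₁) *
        (avoidAll ends a₂ {a₁}).indicator 1 ω) -
    expect p (fun ω => F (cluster ends ω a₁) * (avoidAll ends a₂ {a₁}).indicator 1 ω) *
      expect p (fun ω => G (cluster ends ω a₁) * (avoidAll ends a₂ {a₁}).indicator 1 ω)

/-- `φ(S) = e(S)·(D·h_o(S) − D_o) = D · 1[a₃ ∈ S] · (h_o(S) − γ)`: the jump functional of the (J1) line. -/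
noncomputable def phi (p : E → R) (ends : E → Sym2 V) (o a₁ a₂ a₃ : V) (S : Set V) : R :=
  indS a₃ S * (prob p (PDEvent ends a₁ a₂ a₃) * hS p ends a₂ o S - CovForm.Do p ends o a₁ a₂ a₃)

end Defs

section Towers

variable {V : Type*} {E : Type*} [Fintype E] [DecidableEq E] [Fintype V] [DecidableEq V]
  {R : Type*} [Field R]

variable (p : E → R) (ends : E → Sym2 V) (o a₁ a₂ a₃ b : V)

local notation3 "Q" => avoidAll ends a₂ {a₁}
local notation3 "tL" => connEvent ends a₁ a₃
local notation3 "oH" => connEvent ends a₂ o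
local notation3 "bH" => connEvent ends a₂ b
local notation3 "bL" => connEvent ends a₁ b
local notation3 "𝟙Q" => (avoidAll ends a₂ {a₁}).indicator (1 : Config E → R)

omit [Fintype E] [DecidableEq E] [Fintype V] [DecidableEq V] in
/-- `clusterInEvent ends a₂ univ = univ`. -/
lemma clusterInEvent_univ : clusterInEvent ends a₂ Set.univ = Set.univ := by
  ext ω; simp [clusterInEvent]

omit [Fintype V] [DecidableEq V] in
/-- `delClusterProb` of the trivial event is `1`. -/
lemma delClusterProb_univ (W : Set V) : delClusterProb p ends a₂ Set.univ W = 1 := by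
  unfold delClusterProb; simp [prob_univ]

omit [DecidableEq V] in
/-- Tower (root `a₁`, avoided `{a₂}`): `P(Q, a₃ ∈ C₁, o ∈ C₂, b ∈ C₂) = E[e(C₁) h_{ob}(C₁) 1_Q]`. -/
lemma tower_e_hob : prob p (Q ∩ tL ∩ oH ∩ bH) =
    expect p (fun ω => indS a₃ (cluster ends ω a₁) * hS2 p ends a₂ o b (cluster ends ω a₁) * 𝟙Q ω) := by
  have h := prob_clusterIn_inter_avoid_eq_expect p ends a₁ a₂ (X := {a₂}) (Finset.mem_singleton_self a₂)
    {W : Set V | a₃ ∈ W} ({W : Set V | o ∈ W} ∩ {W : Set V | b ∈ W})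
  rw [← BHKMixed.clusterInEvent_inter, ← connEvent_eq_clusterInEvent ends a₁ a₃,
    ← connEvent_eq_clusterInEvent ends a₂ o, ← connEvent_eq_clusterInEvent ends a₂ b,
    CovForm.avoidAll_root_swap ends a₁ a₂] at h
  have e : tL ∩ (oH ∩ bH) ∩ Q = Q ∩ tL ∩ oH ∩ bH := by
    ext ω; simp only [Set.mem_inter_iff]; tauto
  rw [e] at h
  exact h

omit [DecidableEq V] in
/-- Tower: `P(Q, a₃ ∈ C₁, o ∈ C₂) = E[e(C₁) h_o(C₁) 1_Q]`. -/
lemma tower_e_ho : prob p (Q ∩ tL ∩ oH) =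
    expect p (fun ω => indS a₃ (cluster ends ω a₁) * hS p ends a₂ o (cluster ends ω a₁) * 𝟙Q ω) := by
  have h := prob_clusterIn_inter_avoid_eq_expect p ends a₁ a₂ (X := {a₂}) (Finset.mem_singleton_self a₂)
    {W : Set V | a₃ ∈ W} {W : Set V | o ∈ W}
  rw [← connEvent_eq_clusterInEvent ends a₁ a₃, ← connEvent_eq_clusterInEvent ends a₂ o,
    CovForm.avoidAll_root_swap ends a₁ a₂] at h
  have e : tL ∩ oH ∩ Q = Q ∩ tL ∩ oH := by ext ω; simp only [Set.mem_inter_iff]; tauto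
  rw [e] at h
  exact h

omit [DecidableEq V] in
/-- Tower: `P(Q, a₃ ∈ C₁, b ∈ C₂) = E[e(C₁) h_b(C₁) 1_Q]`. -/
lemma tower_e_hb : prob p (Q ∩ tL ∩ bH) =
    expect p (fun ω => indS a₃ (cluster ends ω a₁) * hS p ends a₂ b (cluster ends ω a₁) * 𝟙Q ω) := by
  have h := prob_clusterIn_inter_avoid_eq_expect p ends a₁ a₂ (X := {a₂}) (Finset.mem_singleton_self a₂)
    {W : Set V | a₃ ∈ W} {W : Set V | b ∈ W}
  rw [← connEvent_eq_clusterInEvent ends a₁ a₃, ← connEvent_eq_clusterInEvent ends a₂ b,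
    CovForm.avoidAll_root_swap ends a₁ a₂] at h
  have e : tL ∩ bH ∩ Q = Q ∩ tL ∩ bH := by ext ω; simp only [Set.mem_inter_iff]; tauto
  rw [e] at h
  exact h

omit [DecidableEq V] in
/-- Tower: `P(Q, a₃ ∈ C₁) = E[e(C₁) 1_Q]`. -/
lemma tower_e : prob p (Q ∩ tL) = expect p (fun ω => indS a₃ (cluster ends ω a₁) * 𝟙Q ω) := by
  have h := prob_clusterIn_inter_avoid_eq_expect p ends a₁ a₂ (X := {a₂}) (Finset.mem_singleton_self a₂)
    {W : Set V | a₃ ∈ W} Set.univ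
  rw [← connEvent_eq_clusterInEvent ends a₁ a₃, CovForm.avoidAll_root_swap ends a₁ a₂,
    clusterInEvent_univ] at h
  have e : tL ∩ Set.univ ∩ Q = Q ∩ tL := by ext ω; simp only [Set.mem_inter_iff, Set.mem_univ]; tauto
  rw [e] at h
  simp only [delClusterProb_univ, mul_one] at h
  exact h

omit [DecidableEq V] in
/-- Tower: `P(Q, b ∈ C₂) = E[h_b(C₁) 1_Q]`. -/
lemma tower_hb : prob p (Q ∩ bH) =
    expect p (fun ω => hS p ends a₂ b (cluster ends ω a₁) * 𝟙Q ω) := by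
  have h := prob_clusterIn_inter_avoid_eq_expect p ends a₁ a₂ (X := {a₂}) (Finset.mem_singleton_self a₂)
    Set.univ {W : Set V | b ∈ W}
  rw [← connEvent_eq_clusterInEvent ends a₂ b, CovForm.avoidAll_root_swap ends a₁ a₂] at h
  have e1 : clusterInEvent ends a₁ Set.univ = Set.univ := by ext ω; simp [clusterInEvent]
  have e2 : Set.univ ∩ bH ∩ Q = Q ∩ bH := by ext ω; simp only [Set.mem_inter_iff, Set.mem_univ]; tauto
  rw [e1, e2] at h
  simp only [Set.indicator_univ, Pi.one_apply, one_mul] at h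
  exact h

omit [DecidableEq V] in
/-- Tower: `P(Q, a₃ ∈ C₁, o ∈ C₂, b ∈ C₁) = E[e(C₁) 1_b(C₁) h_o(C₁) 1_Q]`. -/
lemma tower_e_indb_ho : prob p (Q ∩ tL ∩ oH ∩ bL) =
    expect p (fun ω => indS a₃ (cluster ends ω a₁) * indS b (cluster ends ω a₁) *
      hS p ends a₂ o (cluster ends ω a₁) * 𝟙Q ω) := by
  have h := prob_clusterIn_inter_avoid_eq_expect p ends a₁ a₂ (X := {a₂}) (Finset.mem_singleton_self a₂)
    ({W : Set V | a₃ ∈ W} ∩ {W : Set V | b ∈ W}) {W : Set V | o ∈ W}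
  rw [← BHKMixed.clusterInEvent_inter, ← connEvent_eq_clusterInEvent ends a₁ a₃,
    ← connEvent_eq_clusterInEvent ends a₁ b, ← connEvent_eq_clusterInEvent ends a₂ o,
    CovForm.avoidAll_root_swap ends a₁ a₂] at h
  have e : tL ∩ bL ∩ oH ∩ Q = Q ∩ tL ∩ oH ∩ bL := by
    ext ω; simp only [Set.mem_inter_iff]; tauto
  rw [e] at h
  rw [h]
  congr 1
  funext ω
  unfold indS hS
  rw [Set.inter_indicator_one, Pi.mul_apply]

omit [DecidableEq V] in
/-- Tower: `P(Q, a₃ ∈ C₁, b ∈ C₁) = E[e(C₁) 1_b(C₁) 1_Q]`. -/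
lemma tower_e_indb : prob p (Q ∩ tL ∩ bL) =
    expect p (fun ω => indS a₃ (cluster ends ω a₁) * indS b (cluster ends ω a₁) * 𝟙Q ω) := by
  have h := prob_clusterIn_inter_avoid_eq_expect p ends a₁ a₂ (X := {a₂}) (Finset.mem_singleton_self a₂)
    ({W : Set V | a₃ ∈ W} ∩ {W : Set V | b ∈ W}) Set.univ
  rw [← BHKMixed.clusterInEvent_inter, ← connEvent_eq_clusterInEvent ends a₁ a₃,
    ← connEvent_eq_clusterInEvent ends a₁ b, CovForm.avoidAll_root_swap ends a₁ a₂,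
    clusterInEvent_univ] at h
  have e : tL ∩ bL ∩ Set.univ ∩ Q = Q ∩ tL ∩ bL := by
    ext ω; simp only [Set.mem_inter_iff, Set.mem_univ]; tauto
  rw [e] at h
  simp only [delClusterProb_univ, mul_one] at h
  rw [h]
  congr 1
  funext ω
  unfold indS
  rw [Set.inter_indicator_one, Pi.mul_apply]

omit [DecidableEq V] in
/-- Tower: `P(Q, b ∈ C₁) = E[1_b(C₁) 1_Q]`. -/
lemma tower_indb : prob p (Q ∩ bL) = expect p (fun ω => indS b (cluster ends ω a₁) * 𝟙Q ω) := by
  have h := prob_clusterIn_inter_avoid_eq_expect p ends a₁ a₂ (X := {a₂}) (Finset.mem_singleton_self a₂)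
    {W : Set V | b ∈ W} Set.univ
  rw [← connEvent_eq_clusterInEvent ends a₁ b, CovForm.avoidAll_root_swap ends a₁ a₂,
    clusterInEvent_univ] at h
  have e : bL ∩ Set.univ ∩ Q = Q ∩ bL := by ext ω; simp only [Set.mem_inter_iff, Set.mem_univ]; tauto
  rw [e] at h
  simp only [delClusterProb_univ, mul_one] at h
  exact h

end Towers

section Identities

variable {V : Type*} {E : Type*} [Fintype E] [DecidableEq E] [Fintype V] [DecidableEq V]
  {R : Type*} [Field R]

variable (p : E → R) (ends : E → Sym2 V) (o a₁ a₂ a₃ b : V)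

local notation3 "Q" => avoidAll ends a₂ {a₁}
local notation3 "tL" => connEvent ends a₁ a₃
local notation3 "oH" => connEvent ends a₂ o
local notation3 "bH" => connEvent ends a₂ b
local notation3 "bL" => connEvent ends a₁ b
local notation3 "𝟙Q" => (avoidAll ends a₂ {a₁}).indicator (1 : Config E → R)
local notation3 "D" => prob p (PDEvent ends a₁ a₂ a₃)
local notation3 "Dₒ" => CovForm.Do p ends o a₁ a₂ a₃

omit [DecidableEq V] in
/-- **(i) at `S`-level**: `covS (1[b ∈ ·]) φ = P(Q)·(D·P(T′, o∈C₂, b∈C₁) − D_o·P(T′, b∈C₁)) − P(Q, b∈C₁)·(D·P(T′, o∈C₂) − D_o·P(T′))`,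
i.e. `D · P(Q)² · Cov_{S∼Q}(1[b ∈ S], e·(h_o(S) − γ)) = D · P(Q)² · Cov_μ(1[b ∈ C₁], 1[a₃ ∈ C₁](1[o ∈ C₂] − γ))`
— the cleared (i) of the Z-split is the `S`-covariance with no Harris term. -/
theorem covS_indS_phi_eq :
    covS p ends a₁ a₂ (indS b) (phi p ends o a₁ a₂ a₃) =
      prob p Q * (D * prob p (Q ∩ tL ∩ oH ∩ bL) - Dₒ * prob p (Q ∩ tL ∩ bL)) -
        prob p (Q ∩ bL) * (D * prob p (Q ∩ tL ∩ oH) - Dₒ * prob p (Q ∩ tL)) := by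
  rw [tower_e_indb_ho, tower_e_indb, tower_e_ho, tower_e, tower_indb]
  unfold covS phi
  have x1 : expect p (fun ω => indS b (cluster ends ω a₁) *
      (indS a₃ (cluster ends ω a₁) * (D * hS p ends a₂ o (cluster ends ω a₁) - Dₒ)) * 𝟙Q ω) =
      D * expect p (fun ω => indS a₃ (cluster ends ω a₁) * indS b (cluster ends ω a₁) *
          hS p ends a₂ o (cluster ends ω a₁) * 𝟙Q ω) -
        Dₒ * expect p (fun ω => indS a₃ (cluster ends ω a₁) * indS b (cluster ends ω a₁) * 𝟙Q ω) := by
    rw [← expect_const_mul, ← expect_const_mul, ← expect_sub]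
    congr 1; funext ω; simp only [Pi.sub_apply]; ring
  have x2 : expect p (fun ω => indS a₃ (cluster ends ω a₁) *
      (D * hS p ends a₂ o (cluster ends ω a₁) - Dₒ) * 𝟙Q ω) =
      D * expect p (fun ω => indS a₃ (cluster ends ω a₁) * hS p ends a₂ o (cluster ends ω a₁) * 𝟙Q ω) -
        Dₒ * expect p (fun ω => indS a₃ (cluster ends ω a₁) * 𝟙Q ω) := by
    rw [← expect_const_mul, ← expect_const_mul, ← expect_sub]
    congr 1; funext ω; simp only [Pi.sub_apply]; ring
  rw [x1, x2]

omit [DecidableEq V] in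
/-- **(ii) at `S`-level**: `J1RV.rvTableExpr = D·P(Q)·E[e(C₁)·slack_{bo}(C₁)·1_Q] + covS h_b φ`, i.e.
`Cov_μ(1[b ∈ C₂], 1[a₃ ∈ C₁](1[o ∈ C₂] − γ)) = E_Q[e · Cov_{G∖S}(b, o ∈ C(a₂))] + Cov_{S∼Q}(h_b, e·(h_o − γ))`
(cleared by `D · P(Q)²`). -/
theorem rvTableExpr_eq_slack_add_covS :
    J1RV.rvTableExpr p ends o a₁ a₂ a₃ b =
      D * prob p Q * expect p (fun ω => indS a₃ (cluster ends ω a₁) *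
          slack p ends a₂ b o (cluster ends ω a₁) * 𝟙Q ω) +
        covS p ends a₁ a₂ (hS p ends a₂ b) (phi p ends o a₁ a₂ a₃) := by
  unfold J1RV.rvTableExpr J1RV.pQ J1RV.pQb J1RV.pT1 J1RV.pT1b J1RV.pT1o J1RV.pT1ob
  rw [tower_e_hob, tower_e_hb, tower_e_ho, tower_e, tower_hb]
  unfold covS phi slack
  -- the `hS2 o b` of the tower is the `hS2 b o` of the slack
  have hsym : ∀ W : Set V, hS2 p ends a₂ o b W = hS2 p ends a₂ b o W := by
    intro W; unfold hS2; rw [Set.inter_comm]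
  simp only [hsym]
  have x1 : expect p (fun ω => indS a₃ (cluster ends ω a₁) *
      (hS2 p ends a₂ b o (cluster ends ω a₁) -
        hS p ends a₂ b (cluster ends ω a₁) * hS p ends a₂ o (cluster ends ω a₁)) * 𝟙Q ω) =
      expect p (fun ω => indS a₃ (cluster ends ω a₁) * hS2 p ends a₂ b o (cluster ends ω a₁) * 𝟙Q ω) -
        expect p (fun ω => indS a₃ (cluster ends ω a₁) * hS p ends a₂ b (cluster ends ω a₁) *
          hS p ends a₂ o (cluster ends ω a₁) * 𝟙Q ω) := by
    rw [← expect_sub]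
    congr 1; funext ω; simp only [Pi.sub_apply]; ring
  have x2 : expect p (fun ω => hS p ends a₂ b (cluster ends ω a₁) *
      (indS a₃ (cluster ends ω a₁) * (D * hS p ends a₂ o (cluster ends ω a₁) - Dₒ)) * 𝟙Q ω) =
      D * expect p (fun ω => indS a₃ (cluster ends ω a₁) * hS p ends a₂ b (cluster ends ω a₁) *
          hS p ends a₂ o (cluster ends ω a₁) * 𝟙Q ω) -
        Dₒ * expect p (fun ω => indS a₃ (cluster ends ω a₁) * hS p ends a₂ b (cluster ends ω a₁) *
          𝟙Q ω) := by
    rw [← expect_const_mul, ← expect_const_mul, ← expect_sub]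
    congr 1; funext ω; simp only [Pi.sub_apply]; ring
  have x3 : expect p (fun ω => indS a₃ (cluster ends ω a₁) *
      (D * hS p ends a₂ o (cluster ends ω a₁) - Dₒ) * 𝟙Q ω) =
      D * expect p (fun ω => indS a₃ (cluster ends ω a₁) * hS p ends a₂ o (cluster ends ω a₁) * 𝟙Q ω) -
        Dₒ * expect p (fun ω => indS a₃ (cluster ends ω a₁) * 𝟙Q ω) := by
    rw [← expect_const_mul, ← expect_const_mul, ← expect_sub]
    congr 1; funext ω; simp only [Pi.sub_apply]; ring
  rw [x1, x2, x3]
  ring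

end Identities

end SLevel

end Summit.Ventures.PercRepro2
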